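import Summits.Ventures.HodgeRepro2.T5LevelIdempotent

/-!
# `K`-finite vectors (Tier-5 kernel support, seat p8)

For a representation `ρ` of `G` and a subgroup `K`, the span of the `K`-orbit of a vector
(`orbitSpan`) is the smallest `K`-stable subspace containing it, and the `K`-FINITE vectors —
those whose orbit span is finite-dimensional — form a `K`-stable subspace `kFiniteVectors`,
carried to `K`-finite vectors by equivariant maps.  Every vector whose stabiliser has finite
index in `K` is `K`-finite (`mem_kFiniteVectors_of_finiteIndex`); hence for a smooth
representation and a compact open `K` every vector is `K`-finite (`kFiniteVectors_eq_top`), and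
`K`-invariant vectors are `K`-finite.  This is the algebra behind the «`K`-finite vectors» of the
archimedean part of the record (Harish-Chandra modules: the `K`-finite vectors of an admissible
representation), stated for an abstract group.  Nothing is asserted about any specific group.
-/

namespace Summit.Ventures.HodgeRepro2.T5KFiniteVectors

open Summit.Ventures.HodgeRepro2.LevelPositivity Summit.Ventures.HodgeRepro2.T5LevelIdempotent

variable {G : Type*} [Group G] {k : Type*} [Field k] {V : Type*} [AddCommGroup V] [Module k V]
  (ρ : Representation k G V) (K : Subgroup G)

/-- The span of the `K`-orbit of `v`. -/
def orbitSpan (v : V) : Submodule k V :=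
  Submodule.span k (Set.range fun κ : K => ρ (κ : G) v)

variable {K}

/-- `ρ κ v` lies in the orbit span of `v`. -/
theorem apply_mem_orbitSpan (κ : K) (v : V) : ρ (κ : G) v ∈ orbitSpan ρ K v :=
  Submodule.subset_span ⟨κ, rfl⟩

/-- `v` lies in its own orbit span. -/
theorem mem_orbitSpan_self (v : V) : v ∈ orbitSpan ρ K v := by
  have h := apply_mem_orbitSpan ρ (1 : K) v
  rwa [OneMemClass.coe_one, map_one, Module.End.one_apply] at h

/-- The orbit span is `K`-stable. -/
theorem apply_mem_orbitSpan_of_mem (κ : K) {v w : V} (hw : w ∈ orbitSpan ρ K v) :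
    ρ (κ : G) w ∈ orbitSpan ρ K v := by
  refine Submodule.span_induction ?_ ?_ ?_ ?_ hw
  · rintro _ ⟨κ', rfl⟩
    rw [← Module.End.mul_apply, ← map_mul, ← Subgroup.coe_mul]
    exact apply_mem_orbitSpan ρ (κ * κ') v
  · rw [map_zero]
    exact Submodule.zero_mem _
  · intro x y _ _ hx hy
    rw [map_add]
    exact Submodule.add_mem _ hx hy
  · intro c x _ hx
    rw [map_smul]
    exact Submodule.smul_mem _ c hx

/-- The orbit span is the smallest `K`-stable subspace containing `v`. -/
theorem orbitSpan_le_of_stable {v : V} {W : Submodule k V}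
    (hW : ∀ κ : K, ∀ w ∈ W, ρ (κ : G) w ∈ W) (hv : v ∈ W) : orbitSpan ρ K v ≤ W := by
  apply Submodule.span_le.2
  rintro _ ⟨κ, rfl⟩
  exact hW κ v hv

/-- Translating `v` by `κ ∈ K` does not change its orbit span. -/
theorem orbitSpan_apply (κ : K) (v : V) : orbitSpan ρ K (ρ (κ : G) v) = orbitSpan ρ K v := by
  unfold orbitSpan
  congr 1
  have h : (fun κ' : K => ρ (κ' : G) (ρ (κ : G) v)) =
      (fun κ' : K => ρ (κ' : G) v) ∘ ⇑(Equiv.mulRight κ) := by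
    funext κ'
    simp only [Function.comp_apply, Equiv.coe_mulRight, Subgroup.coe_mul, map_mul,
      Module.End.mul_apply]
  rw [h, (Equiv.mulRight κ).surjective.range_comp]

/-- `orbitSpan (v + w) ≤ orbitSpan v ⊔ orbitSpan w`. -/
theorem orbitSpan_add_le (v w : V) : orbitSpan ρ K (v + w) ≤ orbitSpan ρ K v ⊔ orbitSpan ρ K w := by
  apply Submodule.span_le.2
  rintro _ ⟨κ, rfl⟩
  show ρ (κ : G) (v + w) ∈ orbitSpan ρ K v ⊔ orbitSpan ρ K w
  rw [map_add]
  exact Submodule.add_mem_sup (apply_mem_orbitSpan ρ κ v) (apply_mem_orbitSpan ρ κ w)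

/-- `orbitSpan (c • v) ≤ orbitSpan v`. -/
theorem orbitSpan_smul_le (c : k) (v : V) : orbitSpan ρ K (c • v) ≤ orbitSpan ρ K v := by
  apply Submodule.span_le.2
  rintro _ ⟨κ, rfl⟩
  show ρ (κ : G) (c • v) ∈ orbitSpan ρ K v
  rw [map_smul]
  exact Submodule.smul_mem _ c (apply_mem_orbitSpan ρ κ v)

/-- The orbit span of `0` is `0`. -/
theorem orbitSpan_zero : orbitSpan ρ K (0 : V) = ⊥ := by
  rw [eq_bot_iff]
  apply Submodule.span_le.2
  rintro _ ⟨κ, rfl⟩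
  show ρ (κ : G) (0 : V) ∈ (⊥ : Submodule k V)
  rw [map_zero]
  exact Submodule.zero_mem _

/-- The orbit span of a `K`-invariant vector is its line. -/
theorem orbitSpan_of_mem_invariants {v : V} (hv : v ∈ invariants ρ K) :
    orbitSpan ρ K v = k ∙ v := by
  unfold orbitSpan
  congr 1
  ext w
  constructor
  · rintro ⟨κ, rfl⟩
    exact mem_invariants_iff.1 hv κ κ.2
  · intro hw
    rw [Set.mem_singleton_iff] at hw
    rw [hw]
    refine ⟨1, ?_⟩
    show ρ ((1 : K) : G) v = v
    rw [OneMemClass.coe_one, map_one, Module.End.one_apply]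

variable (K)

/-- The `K`-finite vectors: those whose `K`-orbit spans a finite-dimensional subspace. -/
def kFiniteVectors : Submodule k V where
  carrier := {v | FiniteDimensional k (orbitSpan ρ K v)}
  zero_mem' := by
    show FiniteDimensional k (orbitSpan ρ K (0 : V))
    rw [orbitSpan_zero]
    infer_instance
  add_mem' := by
    intro v w hv hw
    have _ : FiniteDimensional k (orbitSpan ρ K v) := hv
    have _ : FiniteDimensional k (orbitSpan ρ K w) := hw
    exact Submodule.finiteDimensional_of_le (orbitSpan_add_le ρ v w)
  smul_mem' := by
    intro c v hv
    have _ : FiniteDimensional k (orbitSpan ρ K v) := hv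
    exact Submodule.finiteDimensional_of_le (orbitSpan_smul_le ρ c v)

variable {K}

/-- Membership in `kFiniteVectors`. -/
theorem mem_kFiniteVectors_iff {v : V} :
    v ∈ kFiniteVectors ρ K ↔ FiniteDimensional k (orbitSpan ρ K v) :=
  Iff.rfl

/-- A vector is `K`-finite iff it lies in a finite-dimensional `K`-stable subspace. -/
theorem mem_kFiniteVectors_iff_exists {v : V} :
    v ∈ kFiniteVectors ρ K ↔ ∃ W : Submodule k V, FiniteDimensional k W ∧ v ∈ W ∧
      ∀ κ : K, ∀ w ∈ W, ρ (κ : G) w ∈ W := by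
  constructor
  · intro hv
    exact ⟨orbitSpan ρ K v, hv, mem_orbitSpan_self ρ v, fun κ _ hw => apply_mem_orbitSpan_of_mem ρ κ hw⟩
  · rintro ⟨W, hW, hv, hst⟩
    exact Submodule.finiteDimensional_of_le (orbitSpan_le_of_stable ρ hst hv)

/-- The `K`-finite vectors are `K`-stable. -/
theorem apply_mem_kFiniteVectors (κ : K) {v : V} (hv : v ∈ kFiniteVectors ρ K) :
    ρ (κ : G) v ∈ kFiniteVectors ρ K := by
  rw [mem_kFiniteVectors_iff] at hv ⊢
  rwa [orbitSpan_apply]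

/-- `K`-invariant vectors are `K`-finite. -/
theorem invariants_le_kFiniteVectors : invariants ρ K ≤ kFiniteVectors ρ K := by
  intro v hv
  rw [mem_kFiniteVectors_iff, orbitSpan_of_mem_invariants ρ hv]
  infer_instance

/-- A vector whose stabiliser has finite index in `K` is `K`-finite (its orbit is finite). -/
theorem mem_kFiniteVectors_of_finiteIndex {v : V} [(stabilizerIn ρ K v).FiniteIndex] :
    v ∈ kFiniteVectors ρ K := by
  rw [mem_kFiniteVectors_iff]
  have h : Set.range (fun κ : K => ρ (κ : G) v) =
      Set.range (fun c : K ⧸ stabilizerIn ρ K v => ρ ((Quotient.out c : K) : G) v) := by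
    ext w
    constructor
    · rintro ⟨κ, rfl⟩
      exact ⟨(κ : K ⧸ stabilizerIn ρ K v), rep_eq le_rfl κ⟩
    · rintro ⟨c, rfl⟩
      exact ⟨Quotient.out c, rfl⟩
  unfold orbitSpan
  rw [h]
  exact FiniteDimensional.span_of_finite k (Set.finite_range _)

/-- For `K`-finite `ρ` (smooth `ρ`, compact `K`) every vector is `K`-finite. -/
theorem kFiniteVectors_eq_top (hK : KFinite ρ K) : kFiniteVectors ρ K = ⊤ := by
  rw [eq_top_iff]
  intro v _
  haveI := hK v
  exact mem_kFiniteVectors_of_finiteIndex ρ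

/-- In a finite-dimensional representation every vector is `K`-finite. -/
theorem kFiniteVectors_eq_top_of_finiteDimensional [FiniteDimensional k V] :
    kFiniteVectors ρ K = ⊤ := by
  rw [eq_top_iff]
  intro v _
  rw [mem_kFiniteVectors_iff]
  infer_instance

/-- An equivariant map carries `K`-finite vectors to `K`-finite vectors. -/
theorem map_mem_kFiniteVectors {W : Type*} [AddCommGroup W] [Module k W]
    {σ : Representation k G W} {f : V →ₗ[k] W} (hf : ∀ g v, f (ρ g v) = σ g (f v)) {v : V}
    (hv : v ∈ kFiniteVectors ρ K) : f v ∈ kFiniteVectors σ K := by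
  rw [mem_kFiniteVectors_iff] at hv ⊢
  have h : orbitSpan σ K (f v) ≤ (orbitSpan ρ K v).map f := by
    apply Submodule.span_le.2
    rintro _ ⟨κ, rfl⟩
    show σ (κ : G) (f v) ∈ (orbitSpan ρ K v).map f
    rw [← hf]
    exact Submodule.mem_map_of_mem (apply_mem_orbitSpan ρ κ v)
  exact Submodule.finiteDimensional_of_le h

end Summit.Ventures.HodgeRepro2.T5KFiniteVectors
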